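import Literature.MathematicalPhysics.QuantumFieldTheory.Balaban1983to89.T4HistoryPeeling

/-!
# T⁴ programme, spine node NE1′ (O3b/H2), COUPLING LINE — the L4 PLUMBING of the skeleton `t4/skeletons/NE1p-t4-ne1p-p3.md`
# (v0.7, item (m4)): node NE7b's single-slot datum (`T4HistoryPeeling.SwitchOff` + the single-slot conditional ratio bound of
# `SlotDom`) IMPLIES the ERASE-RATIO binder consumed by the coupling line (`T4CouplingDomination.prodDomination_of_eraseRatio`'s
# `hratio`: «weight of the class with pending-slot set `Y` ≤ x_i × weight of the class with `Y.erase i`») and hence the PRODUCT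
# (Peierls) domination of every charge class by the empty-charge class — on one run's own finite term family, nothing else

Cell `pub-balaban`, unit `b2b-balaban-t4-ne1p-p3` (ROUND-2 technique-distinct prover #3 on BINDER row NE1′, technique «coupling of
block-spin towers»), generation 30.  OUR bookkeeping (new work ⇒ `Summits/`), tree vocabulary `T4HistoryPeeling.SwitchOff` BY NAME;
everything is PROVED; no `def … : Prop`; nothing of T. Bałaban's series is asserted or cited (the `SwitchOff` carrier and the
single-slot bound are the CELL's hypothesis shapes of node NE7b — row owner `t4-ne7b-p1` —, located by `T4HistoryPeeling` at
[Balaban1989LargeFieldII] pp. 383–387 as a READING, not a quotation; see that module's header).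

HONEST FRAMING (T4-DAG p. 1).  Rung (B)+1 on ONE finite four-torus of fixed physical size; NOT infinite volume, NOT a mass gap,
NOT the Clay problem, NOT summit progress.  This file discharges NO estimate: it answers the skeleton's open question (q2) «does
NE7b's landed datum shape imply the erase-ratio binder of leaf L4?» — YES, at each fixed cutoff and source strength, by the
switch-off axiom `pend_off_ne` (other flags unchanged) — so leaf L4 of the coupling line is NE7b's currency BY NAME plus this file,
exactly as announced in the skeleton §3 row L4.  HONEST DEPENDENCY (verbatim): continuum YM on T⁴ ⇐ BetaPertH ∧ nine spine estimates
(0/9 proved); BetaPertH ⇐ (D1) ∧ (D4) ∧ CAP+tail; G-an2-4 gates asym, D1 and NE2/3/4.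

WHAT IS PROVED ([folklore]; `Φ : SwitchOff T n`, weights `A ≥ 0` on `T`, activities `x`).
* `charge_off_of_pend` — switching off a pending slot `i` sends the charge class `Y` to `Y.erase i`;
* `sum_charge_eq_le_mul_sum_erase` — THE ERASE-RATIO BOUND: under the single-slot conditional ratio bound
  (`Σ_{τ : pend i τ, off i τ = τ″} A τ ≤ x_i · A τ″` for every context `τ″` with slot `i` off),
  `Σ_{τ ∈ T : charge τ = Y} A τ ≤ x_i · Σ_{τ ∈ T : charge τ = Y.erase i} A τ` for every `i ∈ Y`;
* `sum_charge_eq_le_prod_mul_sum_empty` — iterating: `Σ_{charge = Y} A ≤ (∏_{i ∈ Y} x_i) · Σ_{charge = ∅} A` (`x ≥ 0`) — the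
  Peierls product domination of a charge class by the all-small-field class (complementing the tree's fibre form
  `SwitchOff.fibre_dom`, which is indexed by the total erasure instead of by charge classes).
NOT PROVED, NOT CLAIMED: the single-slot bound itself (node NE7b, not in print for d = 4), the instantiation of `T`, `Φ`, `A` on
Bałaban's (1.104) histories (NODE O), and the measure-space rephrasing used by `T4CouplingDomination` (a finite weighted counting
measure on `T`; the S6 typer's one-liner).
-/

namespace Summit.QuantumFields.BalabanUV.T4Continuum.NE1pEraseRatio

open Finset
open Literature.MathematicalPhysics.QuantumFieldTheory.Balaban1983to89.T4HistoryPeeling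

variable {ι : Type*} {T : Finset ι} {n : ℕ} (Φ : SwitchOff T n) {A : ι → ℝ} {x : Fin n → ℝ}

/-- **SWITCHING OFF A PENDING SLOT ERASES IT FROM THE CHARGE** (and changes nothing else: axiom `pend_off_ne`). [folklore] -/
theorem charge_off_of_pend {i : Fin n} {τ : ι} (_h : Φ.pend i τ = true) : Φ.charge (Φ.off i τ) = (Φ.charge τ).erase i := by
  ext j
  by_cases hj : j = i
  · subst hj
    simp [Φ.pend_off_self]
  · simp [Finset.mem_erase, hj, Φ.pend_off_ne i j τ hj]

/-- A term of charge `Y` with `i ∈ Y` has slot `i` pending. [folklore] -/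
theorem pend_of_charge_eq {Y : Finset (Fin n)} {i : Fin n} (hi : i ∈ Y) {τ : ι} (hτ : Φ.charge τ = Y) :
    Φ.pend i τ = true := by
  rw [← hτ] at hi
  exact Φ.mem_charge.1 hi

/-- A term of charge `Y.erase i` has slot `i` off. [folklore] -/
theorem pend_eq_false_of_charge_eq_erase {Y : Finset (Fin n)} {i : Fin n} {τ : ι} (hτ : Φ.charge τ = Y.erase i) :
    Φ.pend i τ = false := by
  by_contra h
  have h' : Φ.pend i τ = true := by simpa using h
  have : i ∈ Φ.charge τ := Φ.mem_charge.2 h'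
  rw [hτ] at this
  exact Finset.notMem_erase i Y this

/-- **THE ERASE-RATIO BOUND FROM THE SINGLE-SLOT BOUND.**  For non-negative weights and every charge class `Y ∋ i`:
`Σ_{τ ∈ T : charge τ = Y} A τ ≤ x_i · Σ_{τ ∈ T : charge τ = Y.erase i} A τ` — regroup the class along `off i` (which lands in
the class `Y.erase i` by `charge_off_of_pend`) and apply the single-slot bound in each context. [folklore] -/
theorem sum_charge_eq_le_mul_sum_erase [DecidableEq ι] (hA : ∀ τ ∈ T, 0 ≤ A τ)
    (h1 : ∀ i : Fin n, ∀ τ'' ∈ T, Φ.pend i τ'' = false →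
      ∑ τ ∈ T with (Φ.pend i τ = true ∧ Φ.off i τ = τ''), A τ ≤ x i * A τ'')
    (Y : Finset (Fin n)) {i : Fin n} (hi : i ∈ Y) :
    ∑ τ ∈ T with Φ.charge τ = Y, A τ ≤ x i * ∑ τ ∈ T with Φ.charge τ = Y.erase i, A τ := by
  have hmaps : ∀ τ ∈ T.filter (fun τ => Φ.charge τ = Y),
      Φ.off i τ ∈ T.filter (fun τ'' => Φ.charge τ'' = Y.erase i) := by
    intro τ hτ
    rw [Finset.mem_filter] at hτ ⊢
    exact ⟨Φ.off_mem i τ hτ.1, by rw [charge_off_of_pend Φ (pend_of_charge_eq Φ hi hτ.2), hτ.2]⟩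
  rw [← Finset.sum_fiberwise_of_maps_to hmaps, Finset.mul_sum]
  refine Finset.sum_le_sum fun τ'' hτ'' => ?_
  rw [Finset.mem_filter] at hτ''
  have hoff : Φ.pend i τ'' = false := pend_eq_false_of_charge_eq_erase Φ hτ''.2
  refine le_trans ?_ (h1 i τ'' hτ''.1 hoff)
  refine Finset.sum_le_sum_of_subset_of_nonneg ?_ fun τ hτ _ => hA τ (Finset.mem_filter.1 hτ).1
  intro τ hτ
  simp only [Finset.mem_filter] at hτ ⊢
  exact ⟨hτ.1.1, pend_of_charge_eq Φ hi hτ.1.2, hτ.2⟩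

/-- **PEIERLS PRODUCT DOMINATION OF A CHARGE CLASS** by the empty-charge (all-small-field) class:
`Σ_{charge = Y} A ≤ (∏_{i ∈ Y} x_i) · Σ_{charge = ∅} A`, for non-negative weights and activities (iterate the erase-ratio bound).
[folklore] -/
theorem sum_charge_eq_le_prod_mul_sum_empty [DecidableEq ι] (hA : ∀ τ ∈ T, 0 ≤ A τ) (hx : ∀ i, 0 ≤ x i)
    (h1 : ∀ i : Fin n, ∀ τ'' ∈ T, Φ.pend i τ'' = false →
      ∑ τ ∈ T with (Φ.pend i τ = true ∧ Φ.off i τ = τ''), A τ ≤ x i * A τ'')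
    (Y : Finset (Fin n)) :
    ∑ τ ∈ T with Φ.charge τ = Y, A τ ≤ (∏ i ∈ Y, x i) * ∑ τ ∈ T with Φ.charge τ = ∅, A τ := by
  induction Y using Finset.induction_on with
  | empty => simp
  | insert i Y hiY ih =>
    have h := sum_charge_eq_le_mul_sum_erase Φ hA h1 (insert i Y) (Finset.mem_insert_self i Y)
    rw [Finset.erase_insert hiY] at h
    rw [Finset.prod_insert hiY, mul_assoc]
    exact h.trans (mul_le_mul_of_nonneg_left ih (hx i))

end Summit.QuantumFields.BalabanUV.T4Continuum.NE1pEraseRatio
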